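import Literature.RepresentationTheory.Semisimple.BurnsideMatrixSpan
import Literature.RepresentationTheory.Semisimple.CharpolySubquotient
import Mathlib.LinearAlgebra.Matrix.Charpoly.Coeff
import Mathlib.LinearAlgebra.Eigenspace.Basic
import Mathlib.RingTheory.Nilpotent.Basic
import HarnessLib

/-!
# Two rationality criteria for an absolutely irreducible matrix representation: a single
# eigenvalue everywhere forces scalars; one simple rational eigenvalue forces a rational form

Topic `Literature/RepresentationTheory/Semisimple`; companion of `BurnsideMatrixSpan.lean`
(Burnside: the matrices of an irreducible representation over an algebraically closed field span
`M_n`) and of the descent lemma `RegularDescent.exists_conj_apply_mem` of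
`Literature/NumberTheory/Automorphic/PolarizedCompatibleSystemRationalModelsProofs.lean`
([BLGGT] Lemma 5.3.2: descent along an element with `n` DISTINCT rational eigenvalues, for
SEMISIMPLE representations).  Everything here is PROVED; no definitions, no named facts.

Let `k` be a field, `L ⊆ k` a subfield, `G` a group and `φ : G → GL_n(k)` a homomorphism whose
matrices SPAN `M_n(k)` (for `k` algebraically closed this is irreducibility of `kⁿ`, Burnside,
`span_eq_top_of_isIrreducible`).

* `forall_eq_smul_one_of_forall_charpoly_eq_pow` (`char k = 0`): if EVERY `φ(g)` has a single
  eigenvalue, `charpoly φ(g) = (X - c_g)ⁿ`, then every `φ(g) = c_g · 1` is scalar.  (So an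
  irreducible representation of rank `≥ 2` over an algebraically closed field of characteristic
  `0` always contains an element with two distinct eigenvalues.)  Proof: the normalised matrices
  `u · φ(g)/c_g`, `uⁿ = 1`, form a multiplicatively closed set `S` spanning `M_n(k)` whose traces
  lie in the finite set `n · μ_n(k)`; by the non-degeneracy of the trace form `S` is finite
  (Burnside's finiteness argument), so `φ(g)/c_g` has finite order; being unipotent it is `1`
  (characteristic `0`).  Classical (Kolchin–Burnside); e.g. the argument of Curtis–Reiner,
  *Methods* I, (36.1)–(36.2), for linear groups with finitely many traces. [folklore]
* `exists_conj_apply_mem_of_simple_eigenvalue` (any `k`): if all traces `tr φ(g)` lie in `L`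
  and SOME `φ(γ)` has characteristic polynomial `(X - α) · R` with `α ∈ L`, `R ∈ L[X]` and
  `R(α) ≠ 0` (a SIMPLE `L`-rational eigenvalue), then `φ` is `GL_n(k)`-conjugate to an
  `L`-valued homomorphism.  Proof: the Gram matrix `(tr X_i X_j)` of a basis `X_i = φ(g_i)` of
  `M_n(k)` is `L`-rational and invertible, so the `L`-span `𝓛` of `φ(G)` is the set of matrices
  with `L`-rational coordinates, an `L`-form of `M_n(k)` closed under products; the eigenprojector
  `e = R(φγ)/R(α) ∈ 𝓛` has rank one (`α` is simple: the characteristic polynomial of `φ(γ)`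
  restricted to the `α`-eigenspace divides `(X - α) R`), `e = v₀ ⊗ w` with `w(v₀) = 1`; the
  functionals `x ↦ w(X_i x)` embed `kⁿ` into `k^b`, take `L`-values on the `𝓛`-orbit of `v₀`
  (`w(Z Y v₀) = tr(Z Y e) ∈ L`), and the `L`-points of this embedding form an `L`-structure of
  `kⁿ` (linear independence over `L` of vectors in `L^b` survives extension of scalars to `k`)
  stable under `φ(G)`.  In the language of central simple algebras: the `L`-form `𝓛` of
  `M_n(k)` contains an element of reduced rank one, hence is split.  Classical; it SUBSUMES, for
  irreducible `φ`, the regular-element descent of [BLGGT] Lemma 5.3.2 (`n` distinct rational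
  eigenvalues are `n` simple ones). [folklore]

Both are used by `RationalFormRankLeThree.lean` (rational forms of representations of rank
`≤ 3` all of whose eigenvalues are rational) and, through it, by the rank-`3` case of
`Literature.NumberTheory.Automorphic.BLGGT2014_polarized_compatibleSystem_rationalModels`
(Sen-free).

## References

* C. W. Curtis, I. Reiner, *Methods of Representation Theory* I, Wiley (1981), §27 (Burnside),
  §36 (linear groups with finitely many traces are finite).
* T. Barnet-Lamb, T. Gee, D. Geraghty, R. Taylor, *Potential automorphy and change of weight*,
  Ann. of Math. 179 (2014), Lemma 5.3.2. [BarnetlambEtAl2014]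
-/

noncomputable section

open scoped MatrixGroups
open Matrix Polynomial Module Literature.NumberTheory.GaloisRepresentations

namespace Literature.RepresentationTheory.Semisimple

universe u v

variable {k : Type u} [Field k]

/-! ### The trace form on `M_n(k)` and a spanning family -/

/-- `tr(E_{ji} M) = M_{ij}`. [folklore] -/
theorem trace_single_one_mul {n : Type*} [Fintype n] [DecidableEq n] (M : Matrix n n k) (i j : n) :
    (Matrix.single j i (1 : k) * M).trace = M i j := by
  rw [Matrix.trace, Finset.sum_eq_single j]
  · rw [Matrix.diag_apply, Matrix.single_mul_apply_same, one_mul]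
  · intro a _ ha
    rw [Matrix.diag_apply, Matrix.single_mul_apply_of_ne _ _ _ _ _ ha]
  · intro h
    exact absurd (Finset.mem_univ j) h

/-- **Non-degeneracy of the trace form against a spanning family**: if the matrices `X i` span
`M_n(k)` and `tr(X i · M) = 0` for all `i`, then `M = 0`. [folklore] -/
theorem eq_zero_of_forall_trace_mul_eq_zero {n : Type*} [Fintype n] [DecidableEq n] {ι : Type*}
    (X : ι → Matrix n n k) (hX : Submodule.span k (Set.range X) = ⊤) (M : Matrix n n k)
    (hM : ∀ i, (X i * M).trace = 0) : M = 0 := by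
  -- the linear form `Z ↦ tr(Z M)` vanishes on the spanning family, hence everywhere
  let f : Matrix n n k →ₗ[k] k :=
    { toFun := fun Z => (Z * M).trace
      map_add' := fun Z Z' => by rw [Matrix.add_mul, Matrix.trace_add]
      map_smul' := fun c Z => by rw [Matrix.smul_mul, Matrix.trace_smul, RingHom.id_apply] }
  have hle : Submodule.span k (Set.range X) ≤ LinearMap.ker f := by
    rw [Submodule.span_le]
    rintro _ ⟨i, rfl⟩
    exact hM i
  rw [hX, top_le_iff, LinearMap.ker_eq_top] at hle
  have hf : ∀ Z, (Z * M).trace = 0 := fun Z => by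
    have := LinearMap.congr_fun hle Z
    exact this
  ext i j
  rw [← trace_single_one_mul M i j, hf, Matrix.zero_apply]

/-- With a spanning family `X i`, the vector of traces `(tr(X i · M))_i` determines `M`.
[folklore] -/
theorem eq_of_forall_trace_mul_eq {n : Type*} [Fintype n] [DecidableEq n] {ι : Type*}
    (X : ι → Matrix n n k) (hX : Submodule.span k (Set.range X) = ⊤) {M N : Matrix n n k}
    (h : ∀ i, (X i * M).trace = (X i * N).trace) : M = N := by
  rw [← sub_eq_zero]
  refine eq_zero_of_forall_trace_mul_eq_zero X hX _ fun i => ?_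
  rw [Matrix.mul_sub, Matrix.trace_sub, h i, sub_self]

/-! ### Linear independence over a subfield survives extension of scalars -/

/-- **Base change of linear independence along a subfield.**  Vectors `v i ∈ L^m` (`L ⊆ k` a
subfield) which are linearly independent over `L` are linearly independent over `k` when read in
`k^m`: an `L`-linear left inverse of `c ↦ Σ cᵢ vᵢ` (Mathlib
`LinearMap.exists_leftInverse_of_injective`) is a matrix identity `B · V = 1` over `L`, which
survives the ring homomorphism `L → k`. [folklore] -/
theorem linearIndependent_subtype_comp_of_linearIndependent (L : Subfield k) {ι m : Type*}
    [Fintype ι] [Fintype m] (v : ι → m → L) (hv : LinearIndependent L v) :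
    LinearIndependent k (fun i => ((L.subtype : L → k) ∘ v i : m → k)) := by
  classical
  -- the `L`-linear map `c ↦ Σ cᵢ vᵢ` and its matrix
  let f : (ι → L) →ₗ[L] (m → L) := Fintype.linearCombination L v
  have hker : LinearMap.ker f = ⊥ := by
    rw [LinearMap.ker_eq_bot']
    intro c hc
    rw [Fintype.linearCombination_apply] at hc
    funext i
    exact Fintype.linearIndependent_iff.mp hv c hc i
  obtain ⟨g, hg⟩ := f.exists_leftInverse_of_injective hker
  have hmat : LinearMap.toMatrix' g * LinearMap.toMatrix' f = 1 := by
    rw [← LinearMap.toMatrix'_comp, hg, LinearMap.toMatrix'_id]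
  have hF : ∀ a i, LinearMap.toMatrix' f a i = v i a := fun a i => by
    rw [LinearMap.toMatrix'_apply]
    change (Fintype.linearCombination L v (Pi.single i 1)) a = v i a
    rw [Fintype.linearCombination_apply_single, one_smul]
  -- read over `k`
  set FK : Matrix m ι k := (LinearMap.toMatrix' f).map L.subtype with hFK
  set GK : Matrix ι m k := (LinearMap.toMatrix' g).map L.subtype with hGK
  have hmatK : GK * FK = 1 := by
    rw [hGK, hFK, ← Matrix.map_mul, hmat, Matrix.map_one _ L.subtype.map_zero L.subtype.map_one]
  rw [Fintype.linearIndependent_iff]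
  intro c hc i
  have hcomb : FK *ᵥ c = ∑ i, c i • ((L.subtype : L → k) ∘ v i : m → k) := by
    funext a
    rw [Matrix.mulVec, dotProduct, Finset.sum_apply]
    refine Finset.sum_congr rfl fun i _ => ?_
    rw [hFK, Matrix.map_apply, hF, Pi.smul_apply, Function.comp_apply, smul_eq_mul, mul_comm]
  have h0 : FK *ᵥ c = 0 := by rw [hcomb, hc]
  have : c = 0 := by
    have h1 : (GK * FK) *ᵥ c = c := by rw [hmatK, Matrix.one_mulVec]
    rw [← h1, ← Matrix.mulVec_mulVec, h0, Matrix.mulVec_zero]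
  rw [this, Pi.zero_apply]

/-! ### A unipotent element of finite order is trivial (characteristic `0`) -/

/-- In an algebra `A` over a field of characteristic `0`, an element `x` with `x - 1` nilpotent
and `x ^ m = 1` for some `m ≥ 1` equals `1`: `x ^ m - 1 = (x - 1) · Q(x - 1)` with
`Q = ((X+1)^m - 1)/X`, `Q(0) = m` invertible and `Q(x-1) - m` nilpotent, so `Q(x - 1)` is a unit.
[folklore] -/
theorem eq_one_of_pow_eq_one_of_isNilpotent_sub_one [CharZero k] {A : Type*} [Ring A]
    [Algebra k A] {x : A} (hx : IsNilpotent (x - 1)) {m : ℕ} (hm : 0 < m) (hxm : x ^ m = 1) :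
    x = 1 := by
  set N : A := x - 1 with hN
  -- `(X + 1)^m - 1 = X * Q`
  set P : k[X] := (X + 1) ^ m - 1 with hP
  have hP0 : P.coeff 0 = 0 := by
    rw [hP, coeff_sub, coeff_zero_eq_eval_zero, coeff_one_zero]
    simp
  obtain ⟨Q, hQ⟩ : X ∣ P := Polynomial.X_dvd_iff.mpr hP0
  have hQ0 : Q.coeff 0 = (m : k) := by
    have h1 : P.coeff 1 = (m : k) := by
      rw [hP, coeff_sub, coeff_one, if_neg one_ne_zero, sub_zero, add_comm,
        coeff_one_add_X_pow, Nat.choose_one_right]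
    rw [← h1, hQ, coeff_X_mul]
  -- `Q = m + X * Q₁`
  obtain ⟨Q₁, hQ₁⟩ : X ∣ Q - C (Q.coeff 0) := by
    rw [Polynomial.X_dvd_iff, coeff_sub, coeff_C_zero, sub_self]
  have haevalP : aeval N P = 0 := by
    simp only [hP, map_sub, map_pow, map_add, aeval_X, map_one]
    rw [hN, sub_add_cancel, hxm, sub_self]
  have hNQ : N * aeval N Q = 0 := by
    rw [← haevalP, hQ, map_mul, aeval_X]
  -- `aeval N Q` is a unit
  have hunit : IsUnit (aeval N Q) := by
    have hQeq : Q = C (m : k) + X * Q₁ := by rw [← hQ0, ← hQ₁, add_sub_cancel]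
    have haQ : aeval N Q = algebraMap k A (m : k) + N * aeval N Q₁ := by
      conv_lhs => rw [hQeq]
      rw [map_add, aeval_C, map_mul, aeval_X]
    rw [haQ]
    have hmunit : IsUnit (algebraMap k A (m : k)) :=
      (IsUnit.mk0 (m : k) (Nat.cast_ne_zero.mpr hm.ne')).map (algebraMap k A)
    have hnil : IsNilpotent (N * aeval N Q₁) := by
      have hcomm : Commute N (aeval N Q₁) := by
        have h := (Commute.all (X : k[X]) Q₁).map (aeval N : k[X] →ₐ[k] A)
        rwa [aeval_X] at h
      exact hcomm.isNilpotent_mul_right hx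
    have hcomm' : Commute (N * aeval N Q₁) (algebraMap k A (m : k)) :=
      Algebra.commute_algebraMap_right _ _
    exact hnil.isUnit_add_left_of_commute hmunit hcomm'
  obtain ⟨U, hU⟩ := hunit
  have hN0 : N = 0 := by
    have : N * U = 0 := by rw [hU, hNQ]
    simpa using congrArg (· * (↑U⁻¹ : A)) this
  rw [hN, sub_eq_zero] at hN0
  exact hN0

/-! ### A single eigenvalue everywhere forces scalars -/

/-- The `n`-th roots of unity of a field form a finite set. [folklore] -/
theorem finite_setOf_pow_eq_one {n : ℕ} (hn : 0 < n) : {v : k | v ^ n = 1}.Finite := by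
  classical
  refine (Polynomial.nthRoots n (1 : k)).toFinset.finite_toSet.subset fun v hv => ?_
  simpa [Multiset.mem_toFinset, Polynomial.mem_nthRoots hn] using hv

/-- `coeff_{n-1} (X - c)ⁿ = -n c`. [folklore] -/
theorem coeff_X_sub_C_pow_self_sub_one (c : k) {n : ℕ} (hn : 0 < n) :
    ((X - C c) ^ n).coeff (n - 1) = -(n : k) * c := by
  rw [sub_eq_add_neg, ← C_neg, coeff_X_add_C_pow, show n - (n - 1) = 1 by omega, pow_one,
    Nat.choose_symm (Nat.one_le_of_lt hn), Nat.choose_one_right]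
  ring

/-- `coeff_0 (X - c)ⁿ = (-c)ⁿ`. [folklore] -/
theorem coeff_X_sub_C_pow_zero (c : k) (n : ℕ) : ((X - C c) ^ n).coeff 0 = (-c) ^ n := by
  rw [sub_eq_add_neg, ← C_neg, coeff_X_add_C_pow]
  simp

section SingleEigenvalue

variable {G : Type v} [Group G]

/-- **An absolutely irreducible matrix group in which every element has a single eigenvalue is
scalar** (characteristic `0`).  If the matrices `φ(g)` span `M_n(k)` and
`charpoly φ(g) = (X - c_g)ⁿ` for every `g`, then `φ(g) = c_g · 1` for every `g`.  Proof: Burnside's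
finiteness argument applied to the multiplicatively closed set `S = {u · φ(g)/c_g : uⁿ = 1}`,
whose traces against a basis `X_i = φ(g_i)` of `M_n(k)` take finitely many values, so that `S` is
finite by the non-degeneracy of the trace form; hence `φ(g)/c_g` has finite order, and a unipotent
element of finite order is `1` in characteristic `0`
(`eq_one_of_pow_eq_one_of_isNilpotent_sub_one`).  Curtis–Reiner, *Methods* I, §36. [folklore] -/
theorem forall_eq_smul_one_of_forall_charpoly_eq_pow [CharZero k] {n : ℕ} (φ : G →* GL (Fin n) k)
    (hspan : Submodule.span k
      (Set.range fun g => ((φ g : GL (Fin n) k) : Matrix (Fin n) (Fin n) k)) = ⊤)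
    (c : G → k)
    (hc : ∀ g, ((φ g : GL (Fin n) k) : Matrix (Fin n) (Fin n) k).charpoly = (X - C (c g)) ^ n)
    (g : G) : ((φ g : GL (Fin n) k) : Matrix (Fin n) (Fin n) k) = c g • (1 : Matrix (Fin n) (Fin n) k) := by
  classical
  rcases Nat.eq_zero_or_pos n with rfl | hn
  · exact Subsingleton.elim _ _
  haveI : Nonempty (Fin n) := ⟨⟨0, hn⟩⟩
  set M : G → Matrix (Fin n) (Fin n) k := fun g => ((φ g : GL (Fin n) k) : Matrix (Fin n) (Fin n) k)
    with hMdef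
  have hMmul : ∀ g h, M (g * h) = M g * M h := fun g h => by simp [hMdef]
  -- trace and determinant from the characteristic polynomial
  have htr : ∀ g, (M g).trace = (n : k) * c g := fun g => by
    rw [Matrix.trace_eq_neg_charpoly_coeff, hc g, Fintype.card_fin,
      coeff_X_sub_C_pow_self_sub_one _ hn]
    ring
  have hdet : ∀ g, (M g).det = c g ^ n := fun g => by
    rw [Matrix.det_eq_sign_charpoly_coeff, hc g, Fintype.card_fin, coeff_X_sub_C_pow_zero,
      ← mul_pow, neg_one_mul, neg_neg]
  have hc0 : ∀ g, c g ≠ 0 := fun g h0 => by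
    have hu : IsUnit (M g).det := (Matrix.isUnit_iff_isUnit_det _).mp (Units.isUnit (φ g))
    rw [hdet, h0, zero_pow hn.ne'] at hu
    exact not_isUnit_zero hu
  -- `c` is multiplicative up to `n`-th roots of unity
  have hcpow : ∀ g h, (c (g * h) * (c g)⁻¹ * (c h)⁻¹) ^ n = 1 := fun g h => by
    have h1 := hdet (g * h)
    rw [hMmul, Matrix.det_mul, hdet, hdet] at h1
    rw [mul_pow, mul_pow, inv_pow, inv_pow, ← h1]
    field_simp [hc0 g, hc0 h]
  -- nilpotent parts
  have hnil : ∀ g, IsNilpotent (M g - c g • (1 : Matrix (Fin n) (Fin n) k)) := fun g => ⟨n, by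
    have h1 := Matrix.aeval_self_charpoly (M g)
    rwa [hc g, map_pow, map_sub, aeval_X, aeval_C, Algebra.algebraMap_eq_smul_one] at h1⟩
  -- normalised elements `s g = φ(g) / c_g`
  set s : G → Matrix (Fin n) (Fin n) k := fun g => (c g)⁻¹ • M g with hsdef
  have hMs : ∀ g, M g = c g • s g := fun g => by
    rw [hsdef, smul_smul, mul_inv_cancel₀ (hc0 g), one_smul]
  have hs_mul : ∀ g h, s g * s h = (c (g * h) * (c g)⁻¹ * (c h)⁻¹) • s (g * h) := fun g h => by
    simp only [hsdef]
    rw [Matrix.smul_mul, Matrix.mul_smul, smul_smul, ← hMmul, smul_smul]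
    congr 1
    field_simp [hc0 (g * h)]
  have hs_tr : ∀ g, (s g).trace = n := fun g => by
    simp only [hsdef]
    rw [Matrix.trace_smul, htr, smul_eq_mul, ← mul_assoc, mul_comm _ (n : k), mul_assoc,
      inv_mul_cancel₀ (hc0 g), mul_one]
  -- the set `S`
  set S : Set (Matrix (Fin n) (Fin n) k) := {A | ∃ (g : G) (u : k), u ^ n = 1 ∧ A = u • s g}
    with hSdef
  have hS_mul : ∀ A ∈ S, ∀ B ∈ S, A * B ∈ S := by
    rintro _ ⟨g, u, hu, rfl⟩ _ ⟨h, u', hu', rfl⟩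
    refine ⟨g * h, u * u' * (c (g * h) * (c g)⁻¹ * (c h)⁻¹), ?_, ?_⟩
    · rw [mul_pow, mul_pow, hu, hu', hcpow, one_mul, one_mul]
    · rw [Matrix.smul_mul, Matrix.mul_smul, smul_smul, hs_mul, smul_smul]
  have hS_trace : ∀ A ∈ S, ∀ g' : G,
      (A * M g').trace ∈ (fun v : k => c g' * ((n : k) * v)) '' {v : k | v ^ n = 1} := by
    rintro _ ⟨g, u, hu, rfl⟩ g'
    refine ⟨u * (c (g * g') * (c g)⁻¹ * (c g')⁻¹), ?_, ?_⟩
    · show (u * (c (g * g') * (c g)⁻¹ * (c g')⁻¹)) ^ n = 1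
      rw [mul_pow, hu, hcpow, one_mul]
    · show c g' * ((n : k) * (u * (c (g * g') * (c g)⁻¹ * (c g')⁻¹))) = (u • s g * M g').trace
      rw [hMs g', Matrix.smul_mul, Matrix.mul_smul, smul_smul, hs_mul, smul_smul, Matrix.trace_smul,
        hs_tr, smul_eq_mul]
      ring
  -- `S` is finite: traces against a basis extracted from `φ(G)` determine a matrix
  obtain ⟨b, hb, hbspan, hli⟩ := exists_linearIndependent k (Set.range M)
  haveI : Finite b := hli.finite
  have hbspan' : Submodule.span k (Set.range ((↑) : b → Matrix (Fin n) (Fin n) k)) = ⊤ := by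
    rw [Subtype.range_coe, hbspan, hspan]
  choose gb hgb using fun x : b => hb x.2
  let Φ : Matrix (Fin n) (Fin n) k → (b → k) := fun A x => ((x : Matrix (Fin n) (Fin n) k) * A).trace
  have hΦinj : Function.Injective Φ := fun A B hAB =>
    eq_of_forall_trace_mul_eq _ hbspan' fun x => congr_fun hAB x
  have hSfin : S.Finite := by
    have hT : ∀ x : b,
        ((fun v : k => c (gb x) * ((n : k) * v)) '' {v : k | v ^ n = 1}).Finite := fun x =>
      (finite_setOf_pow_eq_one hn).image _
    refine ((Set.Finite.pi' hT).preimage hΦinj.injOn).subset fun A hA => ?_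
    show ∀ x : b, Φ A x ∈ _
    intro x
    show ((x : Matrix (Fin n) (Fin n) k) * A).trace ∈ _
    rw [← hgb x, Matrix.trace_mul_comm]
    exact hS_trace A hA (gb x)
  -- `s g` has finite order
  have hsg_mem : ∀ m : ℕ, s g ^ (m + 1) ∈ S := by
    intro m
    induction m with
    | zero => exact ⟨g, 1, one_pow _, by rw [zero_add, pow_one, one_smul]⟩
    | succ m ih =>
      rw [pow_succ]
      exact hS_mul _ ih _ ⟨g, 1, one_pow _, (one_smul _ _).symm⟩
  obtain ⟨a, a', haa', heq⟩ :=
    Set.Finite.exists_lt_map_eq_of_forall_mem (f := fun m : ℕ => s g ^ (m + 1)) hsg_mem hSfin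
  have hsunit : IsUnit (s g) := by
    rw [Matrix.isUnit_iff_isUnit_det, hsdef, Matrix.det_smul, hdet, Fintype.card_fin,
      isUnit_iff_ne_zero]
    exact mul_ne_zero (pow_ne_zero _ (inv_ne_zero (hc0 g))) (pow_ne_zero _ (hc0 g))
  have hpow : s g ^ (a' - a) = 1 := by
    have h1 : s g ^ (a + 1) * s g ^ (a' - a) = s g ^ (a + 1) * 1 := by
      rw [mul_one, ← pow_add, show a + 1 + (a' - a) = a' + 1 by omega]
      exact heq.symm
    exact (hsunit.pow (a + 1)).mul_left_cancel h1
  -- a unipotent element of finite order is `1`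
  have hs1 : s g = 1 := by
    refine eq_one_of_pow_eq_one_of_isNilpotent_sub_one (k := k) ?_ (Nat.sub_pos_of_lt haa') hpow
    have h1 : s g - 1 = (c g)⁻¹ • (M g - c g • (1 : Matrix (Fin n) (Fin n) k)) := by
      rw [hsdef, smul_sub, smul_smul, inv_mul_cancel₀ (hc0 g), one_smul]
    rw [h1]
    exact (hnil g).smul _
  change M g = c g • 1
  rw [hMs g, hs1]

end SingleEigenvalue

/-! ### Inputs for the simple-eigenvalue descent -/

/-- A polynomial with coefficients in a subfield `L` takes values in `L` at points of `L`.
[folklore] -/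
theorem eval_mem_of_coeff_mem (L : Subfield k) {p : k[X]} (hp : ∀ i, p.coeff i ∈ L) {a : k}
    (ha : a ∈ L) : p.eval a ∈ L := by
  rw [Polynomial.eval_eq_sum_range]
  exact sum_mem fun i _ => mul_mem (hp i) (pow_mem ha i)

/-- `P(A) v = P(μ) v` for an eigenvector `A v = μ v`. [folklore] -/
theorem aeval_mulVec_of_mulVec_eq_smul {N : Type*} [Fintype N] [DecidableEq N] (A : Matrix N N k)
    {v : N → k} {μ : k} (h : A *ᵥ v = μ • v) (p : k[X]) :
    aeval A p *ᵥ v = p.eval μ • v := by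
  have hpow : ∀ i : ℕ, A ^ i *ᵥ v = μ ^ i • v := fun i => by
    induction i with
    | zero => rw [pow_zero, pow_zero, Matrix.one_mulVec, one_smul]
    | succ i ih => rw [pow_succ, ← Matrix.mulVec_mulVec, h, Matrix.mulVec_smul, ih, smul_smul,
        pow_succ']
  induction p using Polynomial.induction_on' with
  | add p q hp hq => rw [map_add, Matrix.add_mulVec, hp, hq, eval_add, add_smul]
  | monomial i a =>
    rw [aeval_monomial, eval_monomial, Algebra.algebraMap_eq_smul_one, Matrix.smul_mul,
      Matrix.one_mul, Matrix.smul_mulVec, hpow, smul_smul]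

/-- `(v₀ ⊗ c) v = c(v) v₀` for the rank-one matrix `vecMulVec v₀ c`. [folklore] -/
theorem vecMulVec_mulVec_eq_smul {N : Type*} [Fintype N] (a c v : N → k) :
    Matrix.vecMulVec a c *ᵥ v = (c ⬝ᵥ v) • a := by
  funext i
  simp only [Matrix.mulVec, dotProduct, Matrix.vecMulVec_apply, Pi.smul_apply, smul_eq_mul,
    Finset.sum_mul]
  exact Finset.sum_congr rfl fun j _ => by ring

/-- The characteristic polynomial of the homothety `α · id` of an `m`-dimensional space is
`(X - α)^m`. [folklore] -/
theorem charpoly_smul_id_eq_pow {V : Type*} [AddCommGroup V] [Module k V] [FiniteDimensional k V]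
    (α : k) : (α • (LinearMap.id : V →ₗ[k] V)).charpoly = (X - C α) ^ (Module.finrank k V) := by
  classical
  let b := Module.finBasis k V
  rw [← LinearMap.charpoly_toMatrix _ b, LinearEquiv.map_smul, LinearMap.toMatrix_id,
    Matrix.smul_one_eq_diagonal,
    Matrix.charpoly_of_upperTriangular _ (Matrix.blockTriangular_diagonal _)]
  simp only [Matrix.diagonal_apply_eq, Finset.prod_const, Finset.card_univ, Fintype.card_fin]

/-- **A simple root of the characteristic polynomial has a one-dimensional eigenspace.**  If
`charpoly A = (X - α) · R` with `R(α) ≠ 0` and `v₀ ≠ 0` is an `α`-eigenvector, every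
`α`-eigenvector is a multiple of `v₀`: the characteristic polynomial of `A` restricted to the
`α`-eigenspace is `(X - α)^{dim}` and divides `charpoly A`
(`LinearMap.charpoly_eq_charpoly_restrict_mul_charpoly_mapQ`). [folklore] -/
theorem exists_smul_eq_of_charpoly_eq_X_sub_C_mul {N : Type*} [Fintype N] [DecidableEq N]
    (A : Matrix N N k) (α : k) (R : k[X]) (hch : A.charpoly = (X - C α) * R) (hRα : R.eval α ≠ 0)
    {v₀ : N → k} (hv₀ : v₀ ≠ 0) (hAv₀ : A *ᵥ v₀ = α • v₀) (w : N → k) (hw : A *ᵥ w = α • w) :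
    ∃ t : k, t • v₀ = w := by
  classical
  set f : (N → k) →ₗ[k] (N → k) := Matrix.toLin' A with hf
  have hfapply : ∀ v, f v = A *ᵥ v := fun v => Matrix.toLin'_apply A v
  set p : Submodule k (N → k) := Module.End.eigenspace f α with hpdef
  have hmem : ∀ v, v ∈ p ↔ A *ᵥ v = α • v := fun v => by
    rw [hpdef, Module.End.mem_eigenspace_iff, hfapply]
  have hp : p ≤ p.comap f := fun x hx => by
    rw [Submodule.mem_comap, hmem, hfapply, (hmem x).mp hx, Matrix.mulVec_smul, (hmem x).mp hx]
  -- the restriction of `f` to `p` is the homothety `α`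
  have hres : (f.restrict (p := p) (q := p) fun _ hx => hp hx) = α • LinearMap.id := by
    refine LinearMap.ext fun x => Subtype.ext ?_
    rw [LinearMap.coe_restrict_apply, LinearMap.smul_apply, LinearMap.id_apply, Submodule.coe_smul,
      hfapply]
    exact (hmem x).mp x.2
  have hfac := LinearMap.charpoly_eq_charpoly_restrict_mul_charpoly_mapQ f p hp
  rw [hres, charpoly_smul_id_eq_pow] at hfac
  have hfA : f.charpoly = A.charpoly := by rw [hf, Matrix.charpoly_toLin']
  have hdvd : (X - C α) ^ Module.finrank k p ∣ (X - C α) * R := by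
    rw [← hch, ← hfA, hfac]
    exact dvd_mul_right _ _
  have hle : Module.finrank k p ≤ 1 := by
    refine le_of_not_gt fun hlt => ?_
    have h2 : (X - C α) ^ 2 ∣ (X - C α) * R := (pow_dvd_pow _ hlt).trans hdvd
    rw [pow_two, mul_dvd_mul_iff_left (X_sub_C_ne_zero α), dvd_iff_isRoot] at h2
    exact hRα h2
  have hv₀p : v₀ ∈ p := (hmem v₀).mpr hAv₀
  have hne : (⟨v₀, hv₀p⟩ : p) ≠ 0 := fun h => hv₀ (congrArg Subtype.val h)
  have hpos : 0 < Module.finrank k p := Module.finrank_pos_iff_exists_ne_zero.mpr ⟨_, hne⟩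
  obtain ⟨t, ht⟩ :=
    (finrank_eq_one_iff_of_nonzero' _ hne).mp (le_antisymm hle hpos) ⟨w, (hmem w).mpr hw⟩
  exact ⟨t, congrArg Subtype.val ht⟩

/-- **Gram lemma: with an `L`-rational invertible Gram matrix, `L`-rational traces give
`L`-rational coordinates.**  Let `B` be a basis of `M_n(k)` with `tr(B_i B_j) ∈ L`.  If
`tr(B_i Y) ∈ L` for all `i`, then all coordinates of `Y` in `B` lie in `L`: they solve the linear
system with the Gram matrix, which is invertible (non-degeneracy of the trace form) and
`L`-rational, so its unique solution is `L`-rational. [folklore] -/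
theorem repr_apply_mem_of_forall_trace_mul_mem (L : Subfield k) {N : Type*} [Fintype N]
    [DecidableEq N] {ι : Type*} [Fintype ι] [DecidableEq ι] (B : Basis ι k (Matrix N N k))
    (hB : ∀ i j, (B i * B j).trace ∈ L) (Y : Matrix N N k) (hY : ∀ i, (B i * Y).trace ∈ L)
    (i : ι) : B.repr Y i ∈ L := by
  set Gm : Matrix ι ι k := Matrix.of fun i j => (B i * B j).trace with hGmdef
  have hGm : ∀ d : ι → k, Gm *ᵥ d = fun i => (B i * ∑ j, d j • B j).trace := fun d => by
    funext i
    rw [Matrix.mulVec, dotProduct, Matrix.mul_sum, Matrix.trace_sum]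
    refine Finset.sum_congr rfl fun j _ => ?_
    rw [hGmdef, Matrix.of_apply, Matrix.mul_smul, Matrix.trace_smul, smul_eq_mul, mul_comm]
  -- the Gram matrix is injective, hence invertible
  have hinj : Function.Injective Gm.mulVec := fun d d' h => by
    have key : ∑ j, d j • B j = ∑ j, d' j • B j :=
      eq_of_forall_trace_mul_eq B B.span_eq fun i => by
        have h1 := congr_fun h i
        rwa [hGm, hGm] at h1
    calc d = ⇑(B.repr (∑ j, d j • B j)) := (B.repr_sum_self d).symm
      _ = ⇑(B.repr (∑ j, d' j • B j)) := by rw [key]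
      _ = d' := B.repr_sum_self d'
  have hunit : IsUnit Gm := Matrix.mulVec_injective_iff_isUnit.mp hinj
  -- its `L`-rational model
  let GmL : Matrix ι ι L := Matrix.of fun i j => ⟨(B i * B j).trace, hB i j⟩
  have hGmL : GmL.map L.subtype = Gm := by
    ext i j
    rfl
  have hdetL : IsUnit GmL.det := by
    rw [isUnit_iff_ne_zero]
    intro h0
    have hdet : Gm.det = 0 := by
      rw [← hGmL, ← RingHom.mapMatrix_apply, ← RingHom.map_det, h0, map_zero]
    exact ((Matrix.isUnit_iff_isUnit_det _).mp hunit |> isUnit_iff_ne_zero.mp) hdet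
  let tL : ι → L := fun i => ⟨(B i * Y).trace, hY i⟩
  let cL : ι → L := GmL⁻¹ *ᵥ tL
  have hcL : GmL *ᵥ cL = tL := by
    show GmL *ᵥ (GmL⁻¹ *ᵥ tL) = tL
    rw [Matrix.mulVec_mulVec, Matrix.mul_nonsing_inv _ hdetL, Matrix.one_mulVec]
  have hck : Gm *ᵥ (fun j => (cL j : k)) = fun i => (tL i : k) := by
    funext i
    have h1 := RingHom.map_mulVec L.subtype GmL cL i
    rw [hGmL, hcL] at h1
    exact h1.symm
  -- the coordinates of `Y` solve the same system
  have hd : Gm *ᵥ (fun j => B.repr Y j) = fun i => (tL i : k) := by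
    rw [hGm]
    funext i
    rw [B.sum_repr Y]
  have hsol := hinj (hd.trans hck.symm)
  rw [congr_fun hsol i]
  exact (cL i).2

/-! ### `L`-forms of `M_n(k)` given by a basis: closure properties -/

section LForm

variable (L : Subfield k) {N : Type*} {ι : Type*}

/-- `L`-rational combinations of matrices with `L`-rational coordinates have `L`-rational
coordinates. [folklore] -/
theorem repr_sum_smul_mem (B : Basis ι k (Matrix N N k)) {σ : Type*} (S : Finset σ) (a : σ → k)
    (Y : σ → Matrix N N k) (ha : ∀ s ∈ S, a s ∈ L) (hY : ∀ s ∈ S, ∀ i, B.repr (Y s) i ∈ L)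
    (i : ι) : B.repr (∑ s ∈ S, a s • Y s) i ∈ L := by
  rw [map_sum, Finsupp.coe_finsetSum, Finset.sum_apply]
  refine sum_mem fun s hs => ?_
  rw [map_smul, Finsupp.coe_smul, Pi.smul_apply, smul_eq_mul]
  exact mul_mem (ha s hs) (hY s hs i)

/-- If the basis is multiplicatively `L`-rational (`B_i B_j` has `L`-rational coordinates), the
matrices with `L`-rational coordinates are closed under products. [folklore] -/
theorem repr_mul_mem [Fintype N] [Fintype ι] (B : Basis ι k (Matrix N N k))
    (hB : ∀ i j l, B.repr (B i * B j) l ∈ L)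
    {Y Z : Matrix N N k} (hY : ∀ i, B.repr Y i ∈ L) (hZ : ∀ i, B.repr Z i ∈ L) (l : ι) :
    B.repr (Y * Z) l ∈ L := by
  have hYZ : Y * Z = ∑ x, B.repr Y x • ∑ y, B.repr Z y • (B x * B y) := by
    conv_lhs => rw [← B.sum_repr Y, ← B.sum_repr Z]
    rw [Finset.sum_mul]
    refine Finset.sum_congr rfl fun x _ => ?_
    rw [Matrix.smul_mul, Matrix.mul_sum]
    congr 1
    exact Finset.sum_congr rfl fun y _ => by rw [Matrix.mul_smul]
  rw [hYZ]
  exact repr_sum_smul_mem L B _ _ _ (fun x _ => hY x) (fun x _ =>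
    repr_sum_smul_mem L B _ _ _ (fun y _ => hZ y) (fun y _ => hB x y)) l

/-- If the basis matrices have traces in `L`, so does every matrix with `L`-rational coordinates.
[folklore] -/
theorem trace_mem_of_repr_mem [Fintype N] [Fintype ι] (B : Basis ι k (Matrix N N k))
    (hB : ∀ i, (B i).trace ∈ L)
    {Y : Matrix N N k} (hY : ∀ i, B.repr Y i ∈ L) : Y.trace ∈ L := by
  rw [← B.sum_repr Y, Matrix.trace_sum]
  refine sum_mem fun x _ => ?_
  rw [Matrix.trace_smul, smul_eq_mul]
  exact mul_mem (hY x) (hB x)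

end LForm

section SimpleEigenvalueDescent

variable {G : Type v} [Group G]

/-- **The `L`-span of an absolutely irreducible `φ(G)` with traces in `L` is an `L`-form of
`M_n(k)`**: for a basis `B` of `M_n(k)` consisting of matrices `φ(g_i)`, every `φ(g)` has
`L`-rational coordinates (Gram lemma `repr_apply_mem_of_forall_trace_mul_mem`:
`tr(B_i φ(g)) = tr φ(g_i g) ∈ L`). [folklore] -/
theorem repr_apply_mem_of_trace_mem (L : Subfield k) {n : ℕ} (φ : G →* GL (Fin n) k)
    (htr : ∀ g, ((φ g : GL (Fin n) k) : Matrix (Fin n) (Fin n) k).trace ∈ L)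
    {ι : Type*} [Fintype ι] [DecidableEq ι] (B : Basis ι k (Matrix (Fin n) (Fin n) k))
    (gB : ι → G) (hgB : ∀ i, B i = ((φ (gB i) : GL (Fin n) k) : Matrix (Fin n) (Fin n) k))
    (g : G) (i : ι) : B.repr ((φ g : GL (Fin n) k) : Matrix (Fin n) (Fin n) k) i ∈ L := by
  refine repr_apply_mem_of_forall_trace_mul_mem L B (fun i j => ?_) _ (fun j => ?_) i
  · rw [hgB, hgB, ← Units.val_mul, ← map_mul]
    exact htr _
  · rw [hgB, ← Units.val_mul, ← map_mul]
    exact htr _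

/-- **Descent from a rank-one element of the `L`-form.**  Let `B` be a basis of `M_n(k)` made of
matrices `φ(g_i)`, such that every `φ(g)` has `L`-rational `B`-coordinates and traces in `L`.  If
some matrix `e = v₀ ⊗ w` of rank one with `w(v₀) = 1` has `L`-rational `B`-coordinates, then `φ`
is `GL_n(k)`-conjugate to an `L`-valued homomorphism: the functionals `x ↦ w(B_i x)` embed `kⁿ`
in `k^ι`, take `L`-values on the vectors `Y v₀`, `Y ∈ 𝓛` (`w(Z Y v₀) = tr(Z Y e)`), and their
`L`-points form a `φ(G)`-stable `L`-structure of `kⁿ` (base change of linear independence,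
`linearIndependent_subtype_comp_of_linearIndependent`). [folklore] -/
theorem exists_conj_apply_mem_of_rankOne (L : Subfield k) {n : ℕ} (φ : G →* GL (Fin n) k)
    (htr : ∀ g, ((φ g : GL (Fin n) k) : Matrix (Fin n) (Fin n) k).trace ∈ L)
    {ι : Type*} [Fintype ι] [DecidableEq ι] (B : Basis ι k (Matrix (Fin n) (Fin n) k))
    (gB : ι → G) (hgB : ∀ i, B i = ((φ (gB i) : GL (Fin n) k) : Matrix (Fin n) (Fin n) k))
    (e : Matrix (Fin n) (Fin n) k) (heL : ∀ i, B.repr e i ∈ L) (v₀ w : Fin n → k)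
    (he : e = Matrix.vecMulVec v₀ w) (hwv₀ : w ⬝ᵥ v₀ = 1) :
    ∃ P : GL (Fin n) k, ∀ g i j,
      ((P * φ g * P⁻¹ : GL (Fin n) k) : Matrix (Fin n) (Fin n) k) i j ∈ L := by
  classical
  set M : G → Matrix (Fin n) (Fin n) k := fun g => ((φ g : GL (Fin n) k) : Matrix (Fin n) (Fin n) k)
    with hMdef
  have hMmul : ∀ g h, M (g * h) = M g * M h := fun g h => by
    simp only [hMdef, map_mul, Units.val_mul]
  have hgB' : ∀ i, B i = M (gB i) := hgB
  -- the `L`-form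
  have isL_M : ∀ g i, B.repr (M g) i ∈ L := fun g i => repr_apply_mem_of_trace_mem L φ htr B gB hgB g i
  have hBmul : ∀ i j l, B.repr (B i * B j) l ∈ L := fun i j l => by
    rw [hgB', hgB', ← hMmul]
    exact isL_M _ _
  have hBtr : ∀ i, (B i).trace ∈ L := fun i => by
    rw [hgB']
    exact htr _
  have hspanB : ⊤ ≤ Submodule.span k (Set.range B) := B.span_eq.ge
  -- the trace identity `tr(Y e) = w(Y v₀)`
  have htr_e : ∀ Y : Matrix (Fin n) (Fin n) k, (Y * e).trace = w ⬝ᵥ (Y *ᵥ v₀) := fun Y => by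
    simp only [he, Matrix.trace, Matrix.diag_apply, Matrix.mul_apply, Matrix.vecMulVec_apply,
      dotProduct, Matrix.mulVec, Finset.mul_sum]
    exact Finset.sum_congr rfl fun a _ => Finset.sum_congr rfl fun c _ => by ring
  -- `L`-values on the orbit of `v₀`
  have hLval : ∀ Y Z : Matrix (Fin n) (Fin n) k, (∀ i, B.repr Y i ∈ L) → (∀ i, B.repr Z i ∈ L) →
      w ⬝ᵥ (Z *ᵥ (Y *ᵥ v₀)) ∈ L := fun Y Z hY hZ => by
    rw [Matrix.mulVec_mulVec, ← htr_e]
    exact trace_mem_of_repr_mem L B hBtr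
      (repr_mul_mem L B hBmul (repr_mul_mem L B hBmul hZ hY) heL)
  -- the embedding `Ψ x = (w(B_i x))_i`
  let Ψ : (Fin n → k) →ₗ[k] (ι → k) :=
    { toFun := fun v i => w ⬝ᵥ ((B i) *ᵥ v)
      map_add' := fun v v' => by
        funext i
        simp only [Matrix.mulVec_add, dotProduct_add, Pi.add_apply]
      map_smul' := fun a v => by
        funext i
        simp only [Matrix.mulVec_smul, dotProduct_smul, smul_eq_mul, Pi.smul_apply,
          RingHom.id_apply] }
  have hΨapply : ∀ v i, Ψ v i = w ⬝ᵥ ((B i) *ᵥ v) := fun _ _ => rfl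
  have hΨinj : Function.Injective Ψ := by
    rw [← LinearMap.ker_eq_bot, LinearMap.ker_eq_bot']
    intro v hv
    by_contra hv0
    have hall : ∀ Y : Matrix (Fin n) (Fin n) k, w ⬝ᵥ (Y *ᵥ v) = 0 := by
      let fv : Matrix (Fin n) (Fin n) k →ₗ[k] k :=
        { toFun := fun Y => w ⬝ᵥ (Y *ᵥ v)
          map_add' := fun Y Z => by
            simp only [Matrix.add_mulVec, dotProduct_add]
          map_smul' := fun a Y => by
            simp only [Matrix.smul_mulVec, dotProduct_smul, RingHom.id_apply] }
      have hle : Submodule.span k (Set.range B) ≤ LinearMap.ker fv := by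
        rw [Submodule.span_le]
        rintro _ ⟨i, rfl⟩
        exact congr_fun hv i
      have htop : LinearMap.ker fv = ⊤ := top_le_iff.mp (hspanB.trans hle)
      intro Y
      exact LinearMap.congr_fun (LinearMap.ker_eq_top.mp htop) Y
    obtain ⟨j₀, hj₀⟩ : ∃ j, v j ≠ 0 := Function.ne_iff.mp hv0
    have h1 := hall (Matrix.vecMulVec v₀ (Pi.single j₀ (v j₀)⁻¹))
    rw [vecMulVec_mulVec_eq_smul, single_dotProduct, inv_mul_cancel₀ hj₀, one_smul, hwv₀] at h1
    exact one_ne_zero h1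
  -- `v₀ ≠ 0`, and the vectors `B_i v₀` span `kⁿ`
  obtain ⟨i₀, hi₀⟩ : ∃ i, v₀ i ≠ 0 := by
    by_contra h
    push Not at h
    have : w ⬝ᵥ v₀ = 0 := by
      rw [show v₀ = 0 from funext h, dotProduct_zero]
    rw [hwv₀] at this
    exact one_ne_zero this
  have hTspan : Submodule.span k (Set.range fun i : ι => (B i) *ᵥ v₀) = ⊤ := by
    let mv : Matrix (Fin n) (Fin n) k →ₗ[k] (Fin n → k) :=
      { toFun := fun Y => Y *ᵥ v₀
        map_add' := fun Y Z => Matrix.add_mulVec _ _ _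
        map_smul' := fun a Y => Matrix.smul_mulVec _ _ _ }
    have hmap : Submodule.span k (Set.range fun i : ι => (B i) *ᵥ v₀) =
        (Submodule.span k (Set.range B)).map mv := by
      rw [Submodule.map_span, ← Set.range_comp]
      rfl
    rw [eq_top_iff]
    rintro v -
    have hv : v = mv (Matrix.vecMulVec v (Pi.single i₀ (v₀ i₀)⁻¹)) := by
      show v = Matrix.vecMulVec v (Pi.single i₀ (v₀ i₀)⁻¹) *ᵥ v₀
      rw [vecMulVec_mulVec_eq_smul, single_dotProduct, inv_mul_cancel₀ hi₀, one_smul]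
    rw [hmap, hv]
    exact Submodule.mem_map_of_mem (hspanB Submodule.mem_top)
  -- a basis of `kⁿ` among them
  obtain ⟨T', hT'sub, hT'span, hliT⟩ :=
    exists_linearIndependent k (Set.range fun i : ι => (B i) *ᵥ v₀)
  haveI : Finite T' := hliT.finite
  letI : Fintype T' := Fintype.ofFinite T'
  have hT'top : ⊤ ≤ Submodule.span k (Set.range ((↑) : T' → (Fin n → k))) := by
    rw [Subtype.range_coe, hT'span, hTspan]
  let BV : Basis T' k (Fin n → k) := Basis.mk hliT hT'top
  have hBV : ∀ t : T', BV t = (t : Fin n → k) := fun t => Basis.mk_apply hliT hT'top t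
  choose xt hxt using fun t : T' => hT'sub t.2
  have hT'card : Fintype.card T' = n := by
    have h1 := Module.finrank_eq_card_basis BV
    rw [Module.finrank_fin_fun] at h1
    exact h1.symm
  have hgood_b : ∀ i j : ι, w ⬝ᵥ ((B j) *ᵥ ((B i) *ᵥ v₀)) ∈ L := fun i j =>
    hLval _ _ (by rw [hgB']; exact isL_M _) (by rw [hgB']; exact isL_M _)
  -- KEY: vectors with `L`-rational `Ψ`-coordinates have `L`-rational `BV`-coordinates
  have hkey : ∀ v : Fin n → k, (∀ i : ι, w ⬝ᵥ ((B i) *ᵥ v) ∈ L) →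
      ∀ t : T', BV.repr v t ∈ L := by
    intro v hv
    let ΨL : T' → ι → L := fun t i =>
      ⟨w ⬝ᵥ ((B i) *ᵥ (t : Fin n → k)), by rw [← hxt t]; exact hgood_b _ _⟩
    let vL : ι → L := fun i => ⟨w ⬝ᵥ ((B i) *ᵥ v), hv i⟩
    have hΨL : ∀ t : T', ((L.subtype : L → k) ∘ ΨL t) = Ψ (t : Fin n → k) := fun t => rfl
    have hvL : ((L.subtype : L → k) ∘ vL) = Ψ v := rfl
    have hsumk : ∀ c : T' → L, Ψ (∑ t, (c t : k) • (t : Fin n → k)) =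
        fun i => (L.subtype : L → k) ((∑ t, c t • ΨL t) i) := fun c => by
      rw [map_sum]
      funext i
      rw [Finset.sum_apply, Finset.sum_apply, map_sum]
      refine Finset.sum_congr rfl fun t _ => ?_
      rw [map_smul, Pi.smul_apply, Pi.smul_apply, smul_eq_mul, smul_eq_mul, map_mul, ← hΨL t]
      rfl
    -- (i) the lifts `ΨL t` are `L`-linearly independent
    have hliL : LinearIndependent L ΨL := by
      rw [Fintype.linearIndependent_iff]
      intro c hc t
      have hck : Ψ (∑ t, (c t : k) • (t : Fin n → k)) = 0 := by
        rw [hsumk, hc]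
        funext i
        rw [Pi.zero_apply, Pi.zero_apply, map_zero]
      have h0 : ∑ t, (c t : k) • (t : Fin n → k) = 0 := hΨinj (by rw [hck, map_zero])
      have h2 := Fintype.linearIndependent_iff.mp hliT (fun t => (c t : k)) h0 t
      exact_mod_cast h2
    -- (ii) adding `vL` makes the family dependent (else `n + 1` independent vectors in `kⁿ`)
    have hdep : ¬ LinearIndependent L (fun o : Option T' => Option.elim o vL ΨL) := by
      intro hind
      have hindk := linearIndependent_subtype_comp_of_linearIndependent L _ hind
      have heq : (fun o : Option T' => ((L.subtype : L → k) ∘ Option.elim o vL ΨL : ι → k)) =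
          Ψ ∘ (fun o : Option T' => Option.elim o v (fun t : T' => (t : Fin n → k))) := by
        funext o
        cases o <;> rfl
      rw [heq] at hindk
      have hcard := (LinearIndependent.of_comp Ψ hindk).fintype_card_le_finrank
      rw [Fintype.card_option, Module.finrank_fin_fun, hT'card] at hcard
      omega
    -- (iii) so `vL` is an `L`-combination of the `ΨL t`
    have hmem : vL ∈ Submodule.span L (Set.range ΨL) := by
      by_contra hnot
      exact hdep (linearIndependent_option.mpr ⟨hliL, hnot⟩)
    obtain ⟨d, hd⟩ := (Submodule.mem_span_range_iff_exists_fun L).mp hmem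
    have hdk : ∑ t, (d t : k) • (t : Fin n → k) = v := by
      apply hΨinj
      rw [hsumk, hd]
      rfl
    intro t
    have hv' : v = ∑ t, (d t : k) • BV t := by
      rw [← hdk]
      exact Finset.sum_congr rfl fun t _ => by rw [hBV]
    rw [hv', Basis.repr_sum_self]
    exact (d t).2
  -- reindex by `Fin n`; the matrices of `φ(g)` in this basis are `L`-rational
  let BF : Basis (Fin n) k (Fin n → k) := BV.reindex (Fintype.equivFinOfCardEq hT'card)
  have hBF : ∀ g (i j : Fin n), BF.repr (M g *ᵥ BF j) i ∈ L := fun g i j => by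
    rw [Basis.repr_reindex_apply, Basis.reindex_apply, hBV, ← hxt, Matrix.mulVec_mulVec]
    exact hkey _ (fun y => hLval _ _
      (repr_mul_mem L B hBmul (isL_M g) (by rw [hgB']; exact isL_M _))
      (by rw [hgB']; exact isL_M _)) _
  -- the conjugating matrix
  let sb := Pi.basisFun k (Fin n)
  refine ⟨⟨BF.toMatrix sb, sb.toMatrix BF, BF.toMatrix_mul_toMatrix_flip sb,
    sb.toMatrix_mul_toMatrix_flip BF⟩, fun g i j => ?_⟩
  have hmat : M g = LinearMap.toMatrix sb sb (Matrix.toLin' (M g)) := by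
    rw [LinearMap.toMatrix_eq_toMatrix', LinearMap.toMatrix'_toLin']
  rw [Units.val_mul, Units.val_mul, Units.inv_mk]
  change (BF.toMatrix sb * M g * sb.toMatrix BF) i j ∈ L
  rw [hmat, basis_toMatrix_mul_linearMap_toMatrix_mul_basis_toMatrix, LinearMap.toMatrix_apply,
    Matrix.toLin'_apply]
  exact hBF g i j

/-- **A simple `L`-rational eigenvalue gives a rank-one element of the `L`-form.**  If
`charpoly φ(γ) = (X - α) R` with `α ∈ L`, `R ∈ L[X]`, `R(α) ≠ 0`, then
`e = R(φγ)/R(α) = v₀ ⊗ w` with `w(v₀) = 1` and `e` has `L`-rational coordinates in any basis of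
`M_n(k)` made of matrices `φ(g_i)` (given traces in `L`). [folklore] -/
theorem exists_rankOne_of_simple_eigenvalue (L : Subfield k) {n : ℕ} (φ : G →* GL (Fin n) k)
    (htr : ∀ g, ((φ g : GL (Fin n) k) : Matrix (Fin n) (Fin n) k).trace ∈ L)
    {ι : Type*} [Fintype ι] [DecidableEq ι] (B : Basis ι k (Matrix (Fin n) (Fin n) k))
    (gB : ι → G) (hgB : ∀ i, B i = ((φ (gB i) : GL (Fin n) k) : Matrix (Fin n) (Fin n) k))
    (γ : G) (α : k) (hα : α ∈ L) (R : k[X]) (hR : ∀ i, R.coeff i ∈ L)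
    (hch : ((φ γ : GL (Fin n) k) : Matrix (Fin n) (Fin n) k).charpoly = (X - C α) * R)
    (hRα : R.eval α ≠ 0) :
    ∃ (e : Matrix (Fin n) (Fin n) k) (v₀ w : Fin n → k), (∀ i, B.repr e i ∈ L) ∧
      e = Matrix.vecMulVec v₀ w ∧ w ⬝ᵥ v₀ = 1 := by
  classical
  set A : Matrix (Fin n) (Fin n) k := ((φ γ : GL (Fin n) k) : Matrix (Fin n) (Fin n) k) with hAdef
  have isL_M : ∀ g i, B.repr ((φ g : GL (Fin n) k) : Matrix (Fin n) (Fin n) k) i ∈ L :=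
    fun g i => repr_apply_mem_of_trace_mem L φ htr B gB hgB g i
  set E : Matrix (Fin n) (Fin n) k := aeval A R with hEdef
  have hEL : ∀ l, B.repr E l ∈ L := fun l => by
    rw [hEdef, aeval_eq_sum_range]
    exact repr_sum_smul_mem L B _ _ (fun i : ℕ => A ^ i) (fun i _ => hR i) (fun i _ l => by
      show B.repr (A ^ i) l ∈ L
      rw [hAdef, ← Units.val_pow_eq_pow_val, ← map_pow]
      exact isL_M _ _) l
  have hAE : ∀ v, A *ᵥ (E *ᵥ v) = α • (E *ᵥ v) := fun v => by
    have hCH := Matrix.aeval_self_charpoly A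
    rw [hch, map_mul, map_sub, aeval_X, aeval_C, Algebra.algebraMap_eq_smul_one] at hCH
    have h1 := congrArg (fun T : Matrix (Fin n) (Fin n) k => T *ᵥ v) hCH
    simp only [Matrix.zero_mulVec, ← Matrix.mulVec_mulVec, Matrix.sub_mulVec,
      Matrix.smul_mulVec, Matrix.one_mulVec, sub_eq_zero] at h1
    exact h1
  obtain ⟨v₀, hv₀, hAv₀⟩ : ∃ v₀ : Fin n → k, v₀ ≠ 0 ∧ A *ᵥ v₀ = α • v₀ := by
    have hdet : (Matrix.scalar (Fin n) α - A).det = 0 := by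
      rw [← Matrix.eval_charpoly, hch]
      simp
    obtain ⟨v₀, hv₀, hv⟩ := Matrix.exists_mulVec_eq_zero_iff.mpr hdet
    refine ⟨v₀, hv₀, ?_⟩
    have hsc : Matrix.scalar (Fin n) α *ᵥ v₀ = α • v₀ := by
      funext i
      simp [Matrix.scalar_apply, Matrix.mulVec_diagonal]
    rw [Matrix.sub_mulVec, sub_eq_zero, hsc] at hv
    exact hv.symm
  have hEv₀ : E *ᵥ v₀ = R.eval α • v₀ := by
    rw [hEdef]
    exact aeval_mulVec_of_mulVec_eq_smul A hAv₀ R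
  set e : Matrix (Fin n) (Fin n) k := (R.eval α)⁻¹ • E with hedef
  have heL : ∀ l, B.repr e l ∈ L := fun l => by
    rw [hedef, map_smul, Finsupp.coe_smul, Pi.smul_apply, smul_eq_mul]
    exact mul_mem (inv_mem (eval_mem_of_coeff_mem L hR hα)) (hEL l)
  have hev₀ : e *ᵥ v₀ = v₀ := by
    rw [hedef, Matrix.smul_mulVec, hEv₀, smul_smul, inv_mul_cancel₀ hRα, one_smul]
  have hAe : ∀ v, A *ᵥ (e *ᵥ v) = α • (e *ᵥ v) := fun v => by
    rw [hedef, Matrix.smul_mulVec, Matrix.mulVec_smul, hAE, smul_comm]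
  have hrank : ∀ v, ∃ t : k, t • v₀ = e *ᵥ v := fun v =>
    exists_smul_eq_of_charpoly_eq_X_sub_C_mul A α R hch hRα hv₀ hAv₀ _ (hAe v)
  -- the covector `w`
  obtain ⟨i₀, hi₀⟩ : ∃ i, v₀ i ≠ 0 := Function.ne_iff.mp hv₀
  let w : Fin n → k := fun j => (v₀ i₀)⁻¹ * e i₀ j
  have hwdot : ∀ v, w ⬝ᵥ v = (v₀ i₀)⁻¹ * (e *ᵥ v) i₀ := fun v => by
    simp only [w, dotProduct, Matrix.mulVec, Finset.mul_sum]
    exact Finset.sum_congr rfl fun j _ => by ring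
  have hw : ∀ v, e *ᵥ v = (w ⬝ᵥ v) • v₀ := fun v => by
    obtain ⟨t, ht⟩ := hrank v
    have hti : t = w ⬝ᵥ v := by
      have h1 := congr_fun ht i₀
      rw [Pi.smul_apply, smul_eq_mul] at h1
      rw [hwdot, ← h1, mul_comm, mul_assoc, mul_inv_cancel₀ hi₀, mul_one]
    rw [← ht, hti]
  have hwv₀ : w ⬝ᵥ v₀ = 1 := by
    have h1 := congr_fun (hw v₀) i₀
    rw [hev₀, Pi.smul_apply, smul_eq_mul] at h1
    exact (mul_eq_right₀ hi₀).mp h1.symm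
  refine ⟨e, v₀, w, heL, ?_, hwv₀⟩
  ext a j
  have h1 := congr_fun (hw (Pi.single j 1)) a
  rw [Matrix.mulVec_single_one, Matrix.col_apply, Pi.smul_apply, smul_eq_mul,
    dotProduct_single_one, mul_comm] at h1
  rw [Matrix.vecMulVec_apply]
  exact h1

/-- **Simple-eigenvalue descent.**  Let `φ : G → GL_n(k)` be a homomorphism whose matrices span
`M_n(k)` and have traces in the subfield `L`, and suppose some `φ(γ)` has characteristic
polynomial `(X - α) · R` with `α ∈ L`, `R ∈ L[X]`, `R(α) ≠ 0` (a simple `L`-rational eigenvalue).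
Then `φ` is `GL_n(k)`-conjugate to an `L`-valued homomorphism (`exists_rankOne_of_simple_eigenvalue`
and `exists_conj_apply_mem_of_rankOne`, for a basis of `M_n(k)` extracted from `φ(G)`).  For
irreducible `φ` over an algebraically closed field this contains the regular-element descent of
[BLGGT], Lemma 5.3.2. [folklore] -/
theorem exists_conj_apply_mem_of_simple_eigenvalue (L : Subfield k) {n : ℕ} (φ : G →* GL (Fin n) k)
    (hspan : Submodule.span k
      (Set.range fun g => ((φ g : GL (Fin n) k) : Matrix (Fin n) (Fin n) k)) = ⊤)
    (htr : ∀ g, ((φ g : GL (Fin n) k) : Matrix (Fin n) (Fin n) k).trace ∈ L)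
    (γ : G) (α : k) (hα : α ∈ L) (R : k[X]) (hR : ∀ i, R.coeff i ∈ L)
    (hch : ((φ γ : GL (Fin n) k) : Matrix (Fin n) (Fin n) k).charpoly = (X - C α) * R)
    (hRα : R.eval α ≠ 0) :
    ∃ P : GL (Fin n) k, ∀ g i j,
      ((P * φ g * P⁻¹ : GL (Fin n) k) : Matrix (Fin n) (Fin n) k) i j ∈ L := by
  classical
  -- a basis of `M_n(k)` inside `φ(G)`
  obtain ⟨b, hb, hbspan, hli⟩ := exists_linearIndependent k
    (Set.range fun g => ((φ g : GL (Fin n) k) : Matrix (Fin n) (Fin n) k))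
  haveI : Finite b := hli.finite
  letI : Fintype b := Fintype.ofFinite b
  have hbtop : ⊤ ≤ Submodule.span k (Set.range ((↑) : b → Matrix (Fin n) (Fin n) k)) := by
    rw [Subtype.range_coe, hbspan, hspan]
  let B : Basis b k (Matrix (Fin n) (Fin n) k) := Basis.mk hli hbtop
  choose gb hgb using fun x : b => hb x.2
  have hgB : ∀ x : b, B x = ((φ (gb x) : GL (Fin n) k) : Matrix (Fin n) (Fin n) k) := fun x => by
    rw [Basis.mk_apply]
    exact (hgb x).symm
  obtain ⟨e, v₀, w, heL, he, hwv₀⟩ :=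
    exists_rankOne_of_simple_eigenvalue L φ htr B gb hgB γ α hα R hR hch hRα
  exact exists_conj_apply_mem_of_rankOne L φ htr B gb hgB e heL v₀ w he hwv₀

/-- The same for an **irreducible** representation over an **algebraically closed** field
(Burnside, `span_eq_top_of_isIrreducible`). [folklore] -/
theorem exists_conj_apply_mem_of_simple_eigenvalue_of_isIrreducible [IsAlgClosed k]
    (L : Subfield k) {n : ℕ} (φ : G →* GL (Fin n) k)
    [Representation.IsIrreducible ((glStdRepresentation (Fin n) k).comp φ)]
    (htr : ∀ g, ((φ g : GL (Fin n) k) : Matrix (Fin n) (Fin n) k).trace ∈ L)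
    (γ : G) (α : k) (hα : α ∈ L) (R : k[X]) (hR : ∀ i, R.coeff i ∈ L)
    (hch : ((φ γ : GL (Fin n) k) : Matrix (Fin n) (Fin n) k).charpoly = (X - C α) * R)
    (hRα : R.eval α ≠ 0) :
    ∃ P : GL (Fin n) k, ∀ g i j,
      ((P * φ g * P⁻¹ : GL (Fin n) k) : Matrix (Fin n) (Fin n) k) i j ∈ L :=
  exists_conj_apply_mem_of_simple_eigenvalue L φ (span_eq_top_of_isIrreducible φ) htr γ α hα R
    hR hch hRα

/-- The scalar criterion for an **irreducible** representation over an **algebraically closed**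
field of characteristic `0` (Burnside, `span_eq_top_of_isIrreducible`). [folklore] -/
theorem forall_eq_smul_one_of_forall_charpoly_eq_pow_of_isIrreducible [IsAlgClosed k] [CharZero k]
    {n : ℕ} (φ : G →* GL (Fin n) k)
    [Representation.IsIrreducible ((glStdRepresentation (Fin n) k).comp φ)] (c : G → k)
    (hc : ∀ g, ((φ g : GL (Fin n) k) : Matrix (Fin n) (Fin n) k).charpoly = (X - C (c g)) ^ n)
    (g : G) : ((φ g : GL (Fin n) k) : Matrix (Fin n) (Fin n) k) = c g • (1 : Matrix (Fin n) (Fin n) k) :=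
  forall_eq_smul_one_of_forall_charpoly_eq_pow φ (span_eq_top_of_isIrreducible φ) c hc g

end SimpleEigenvalueDescent

end Literature.RepresentationTheory.Semisimple

end
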